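import Literature.AnabelianGeometry.SemiGraphs.FiniteEtaleCoveringGlobalDef
import Literature.AnabelianGeometry.SemiGraphs.PiPresentationBridge
import Literature.AnabelianGeometry.SemiGraphs.ZariskiMainTheorem

/-!
# Branch alignment is a CONDITION on a morphism, not a property of every morphism
# ([SemiAnbd] Def. 2.2 (i) p. 23) — the universal closure of `Hom.IsBranchAligned` refuted

Mochizuki, *Semi-graphs of anabelioids*, Publ. RIMS **42** (2006) 221–322, §2, Definition 2.2 (i),
author's manuscript p. 23 [cite: MochizukiSemiAnbd2006, Def. 2.2(i) p.23].  The tree's predicate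
`Hom.IsBranchAligned φ` (`FiniteEtaleCoveringGlobalDef.lean`, abc-iut-L4-t17) types the clause
"the branch groups of the covering are `Π_b ∩ Π_{v′}` in the aligned frame, and distinct branches over
`b` give distinct double cosets" for an ARBITRARY morphism `φ : 𝒢′ → 𝒢`.  Its instance form at
print's construction is a theorem (`BObj.coveringHomCan_isBranchAligned`,
`CoveringHomCanBranchAligned.lean`); this PROOF-ONLY file records that the predicate is NOT
universally valid (abc-iut FACT-LIST row F-1492: «universal closure REFUTED; instance form PROVED»).

The witness (`Hom.not_forall_isBranchAligned`): on the bouquet `H_1` (one vertex, one loop) take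
every constituent anabelioid to be `B(ℤ/2)` with TRIVIAL branch maps, and let `φ : 𝒢 → 𝒢` be the
identity on the semi-graph with `φ_v := B(ℤ/2 → 1 → ℤ/2)` (trivial homomorphism), `φ_e := B(id)`.
Then `π₁(φ_v) : Π_v → Π_v` is trivial, so clause (i) of branch alignment,
`π₁(φ_v)⁻¹(Π_b^{al}) ≤ Π_{b′}`, demands `Π_v ≤ Π_{b′}`; but `Π_{b′}` — the image of `Π_e` under the
TRIVIAL branch map — is trivial, while `Π_v = ℤ/2` ("act by the generator" on the forgetful
basepoint, `π₁(B(G)) = G`).  Nothing here bears on [IUTchIII] Cor. 3.12; no side is taken.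
No definitions, no facts.
-/

namespace Literature.AnabelianGeometry.SemiGraphs

open CategoryTheory CategoryTheory.Limits CategoryTheory.PreGaloisCategory
open Literature.AnabelianGeometry.Anabelioids
open Literature.AlgebraicGeometry.Frobenioids (BCat)
open scoped FintypeCatDiscrete

namespace SemiGraphOfAnabelioids

/-- `π₁` of the restriction functor along the TRIVIAL homomorphism `1 : H → G` kills every
automorphism of the forgetful basepoint of `B(H)` (for `H` profinite, where these automorphisms are
"act by `h`", [GeoAn] §1.1: `π₁(B(H)) = H` and `π₁(B(1)) = 1`). [cite: MochizukiGeoAn2004, §1.1 p.9] -/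
theorem pi1Map_res_one_eq_one {G H : Type} [Group G] [TopologicalSpace G] [IsTopologicalGroup G]
    [Group H] [TopologicalSpace H] [IsTopologicalGroup H] [CompactSpace H] [T2Space H]
    [TotallyDisconnectedSpace H]
    (σ : Aut (ObjectProperty.ι (Action.IsContinuous (V := FintypeCat.{0}) (G := H)) ⋙
      Action.forget FintypeCat.{0} H)) :
    pi1Map (ContAction.res FintypeCat.{0} (1 : H →ₜ* G))
      (ObjectProperty.ι (Action.IsContinuous (V := FintypeCat.{0}) (G := H)) ⋙
        Action.forget FintypeCat.{0} H) σ = 1 := by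
  obtain ⟨eH, heH⟩ := exists_continuousMulEquiv_aut_forget (G := H)
  obtain ⟨h, rfl⟩ := eH.surjective σ
  apply Iso.ext
  apply NatTrans.ext
  funext X
  rw [pi1Map_res_app (1 : H →ₜ* G) (eH h) h (heH h) X]
  change X.obj.ρ ((1 : H → G) h) = _
  rw [Pi.one_apply, map_one]
  rfl

/-- **The universal closure of `Hom.IsBranchAligned` is false** (abc-iut FACT-LIST row F-1492: the
row is a PREDICATE — [SemiAnbd] Def. 2.2 (i) p. 23 gives it for the covering CONSTRUCTED from an
object of `B(𝒢)`, where it is the theorem `BObj.coveringHomCan_isBranchAligned`, not for every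
morphism): on the bouquet `H_1` with all constituents `B(ℤ/2)` and trivial branch maps, the
endomorphism with trivial vertex component violates clause (i) (`ι⁻¹(Π_b^{al}) = Π_v = ℤ/2`, while
`Π_{b′} = 1`). [cite: MochizukiSemiAnbd2006, Def. 2.2(i) p.23] -/
theorem Hom.not_forall_isBranchAligned :
    ¬ ∀ (𝒢 𝒢' : SemiGraphOfAnabelioids.{0, 1, 0}) (φ : Hom 𝒢' 𝒢), φ.IsBranchAligned := by
  intro h
  -- the model: bouquet `H_1`, all groups `ℤ/2`, all branch maps trivial
  let 𝔊 : SemiGraphOfGroups (SemiGraph.bouquet.{0} 1) :=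
    { GV := fun _ => Multiplicative (ZMod 2)
      GE := fun _ => Multiplicative (ZMod 2)
      hom := fun _ _ _ => 1 }
  -- the endomorphism with trivial vertex component and identity edge component
  let t : Multiplicative (ZMod 2) →ₜ* Multiplicative (ZMod 2) := 1
  have ht : t.comp t = t.comp (ContinuousMonoidHom.id _) := by
    ext x
    rfl
  let φ : Hom 𝔊.toAnabelioids 𝔊.toAnabelioids :=
    { base := 𝟙 _
      φV := fun _ => bCatMap t
      φE := fun _ _ _ => bCatMap (ContinuousMonoidHom.id _)
      φB := fun _ _ _ =>
        (ContAction.resComp FintypeCat.{0} t t).symm ≪≫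
          ContAction.resCongr FintypeCat.{0} _ _ ht ≪≫
          ContAction.resComp FintypeCat.{0} (ContinuousMonoidHom.id _) t }
  -- the vertex `v_H`, the branch `b₀`, and the forgetful basepoints of `B(ℤ/2)` there
  let v₀ : 𝔊.toAnabelioids.graph.Vertex := PUnit.unit
  let b₀ : 𝔊.toAnabelioids.graph.Branch := ⟨(0, false)⟩
  have hb₀ : 𝔊.toAnabelioids.graph.abuts b₀ = some v₀ := rfl
  have hp₀ : φ.base.branchMap b₀ = b₀ := rfl
  let F : 𝔊.toAnabelioids.V v₀ ⥤ FintypeCat.{0} :=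
    ObjectProperty.ι (Action.IsContinuous (V := FintypeCat.{0}) (G := Multiplicative (ZMod 2))) ⋙
      Action.forget FintypeCat.{0} (Multiplicative (ZMod 2))
  haveI hF : FiberFunctor F := fiberFunctor_forget_bCat (Multiplicative (ZMod 2))
  let Fe : 𝔊.toAnabelioids.E (𝔊.toAnabelioids.graph.edgeOf b₀) ⥤ FintypeCat.{0} :=
    ObjectProperty.ι (Action.IsContinuous (V := FintypeCat.{0}) (G := Multiplicative (ZMod 2))) ⋙
      Action.forget FintypeCat.{0} (Multiplicative (ZMod 2))
  haveI hFe : FiberFunctor Fe := fiberFunctor_forget_bCat (Multiplicative (ZMod 2))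
  let α₀ : (𝔊.toAnabelioids.pull b₀ v₀ hb₀).pullback ⋙ Fe ≅ F := Iso.refl _
  -- clause (i) at `v′ = v_H`, `F′ = F`, `b = b′ = b₀`, `F_e′ = Fe`, `α′ = 1`
  obtain ⟨hle, -⟩ := h _ _ φ v₀ F b₀
  have hle₀ := hle b₀ hb₀ hp₀ Fe α₀
  -- `Π_v = ℤ/2`: the automorphism "act by the generator"
  obtain ⟨eK, -⟩ := exists_continuousMulEquiv_aut_forget (G := Multiplicative (ZMod 2))
  let k : Multiplicative (ZMod 2) := Multiplicative.ofAdd 1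
  have hk : k ≠ 1 := by decide
  -- it lies in `ι⁻¹(Π_b^{al})` since `ι = π₁(res 1)` is trivial …
  have h1 : pi1Map (φ.φV v₀).pullback F (eK k) = 1 := pi1Map_res_one_eq_one (eK k)
  have hmem : eK k ∈ (φ.alignedBranchSubgroup b₀ v₀ hb₀ b₀ hp₀ F Fe α₀).comap
      (pi1Map (φ.φV v₀).pullback F) :=
    Subgroup.mem_comap.mpr ((congrArg (· ∈ φ.alignedBranchSubgroup b₀ v₀ hb₀ b₀ hp₀ F Fe α₀) h1).mpr
      (one_mem _))
  -- … hence, by clause (i), in `Π_{b′}` = image of `Π_e` under the trivial branch map = `1`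
  obtain ⟨τ, hτ⟩ := MonoidHom.mem_range.mp (hle₀ hmem)
  have h2 : pi1Map (𝔊.toAnabelioids.pull b₀ v₀ hb₀).pullback Fe τ = 1 :=
    pi1Map_res_one_eq_one τ
  have h3 : eK k = 1 :=
    calc eK k = Aut.autMulEquivOfIso α₀ (pi1Map (𝔊.toAnabelioids.pull b₀ v₀ hb₀).pullback Fe τ) :=
          hτ.symm
      _ = 1 := by rw [h2, map_one]
  exact hk (eK.injective (h3.trans (map_one eK).symm))

end SemiGraphOfAnabelioids

end Literature.AnabelianGeometry.SemiGraphs
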